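import Summits.CriticalPhenomena.PercolationContinuityZ3.Theorems.PercNearOneGluingNoHeavyLowerTailTIncSwitching
import Summits.CriticalPhenomena.PercolationContinuityZ3.Theorems.PercNearOneGluingNoHeavyLowerTailAGPlusSwitchingCertificate
import Summits.CriticalPhenomena.PercolationContinuityZ3.Theorems.PercNearOneGluingNoHeavyLowerTailThreePointRowLinks
import Mathlib.Tactic.Ring
import Mathlib.Tactic.Linarith
import HarnessLib

/-!
# `NoHeavyLowerTail` (stmt-CriticalPhenomena-4575) — THEOREM `AG⁺`: the Aas–Gladkov inequality WITH THE CUBIC TERM,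
# `μ(abc)·μ(a|b|c) ≥ u_ab u_ac + u_ab u_bc + u_ac u_bc + u_ab u_ac u_bc` on EVERY finite weighted graph (four-switching proof), II

Support file (prover prim-ineq-prove-3; `--supports stmt-CriticalPhenomena-4575`).  No named facts, no sorries.

**Theorem** (`agPlus_prodBernoulli`).  For Bernoulli bond percolation `prodBernoulli w` with arbitrary edge weights on a finite
vertex type and any vertices `a b c`, with the five cells `t = μ(abc)`, `q = μ(a|b|c)`, `u_c = μ(ab|c)`, `u_b = μ(ac|b)`,
`u_a = μ(a|bc)`:
`u_c u_b u_a ≤ q t − (u_c u_b + u_c u_a + u_b u_a)`   (finitary form `agPlus_PrW`).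
This is the row `AG⁺` / `G3` / `SF3-G3` / `Ξ` of the inequality harness (prim-lit-2, prim-ineq-prove-2: "strong Aas–Gladkov with the
cubic term"; census-validated, previously proved only for `n ≤ 5` and, on all graphs, by prim-ineq-prove-3's FOUR-copy machine
certificate THEOREM-AGPLUS-4COPY.md which is not in Lean).  It sharpens the Aas–Gladkov / strong Harris–Kleitman inequality
`q t ≥ e₂(u)` [Gladkov2024StrongFKG, Cor. 4.2] (`prodBernoulli_threePoint_strongHarris`) by the cubic term `e₃(u)`, and it implies at
once the two irreducible three-point Sahi triples: `3PT-LB = (1+t)·AG − e₃ ≥ 0` (`ThreePointLB.sahiE3_pairSep_nonneg`; with this file also `sahiE3_pairSep_nonneg_of_G3' w a b c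
(agPlus_prodBernoulli w a b c)` of `…ThreePointRowLinks`, whose hypothesis `hG3` is exactly the statement proved here) and
`T_inc = (1+q)·AG − e₃ ≥ 0` (`TIncSwitching.tIncRow_holds`), since `AG = qt − e₂ ≥ e₃ ≥ 0`.

**Proof** (prim-ineq-prove-3 gen 7, THEOREM-AGPLUS-3COPY.md, certificate "I4", 2026-08-20).  Three independent copies `X, Y, Z`; FOUR
measure-preserving switchings exploring copy `X`, all already in the tree: `Φ₁ = phi1 a` (`a→Y`), the reveal-only programs
`Ψ₂ = psi3 b c` (`b` revealed, then `c→Z`) and `Ψ₃ = psi4 c a` (`c` revealed, then `a→Y`) of `…TIncSwitchingMaps`, and the two-region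
exchange `Φ₄ = phi4 a c` (`c→Z; a→Y`) of `…ThreePointLBSwitchingMaps`; `±1` potentials on box events including ONE feature of the
`X`-output (`certI4`); POINTWISE `S = λ₀ + Σ λᵢ∘Φᵢ ≤ 0` (`certI4_nonpos`: the sealed-cluster facts rewrite everything into sixteen atoms,
the cluster lemmas of `…ThreePointLBSwitchingClusters` / `…TIncSwitching` give fifteen implications, and the finite check is
`certP_nonpos` of file I); `E[S] = −AG⁺` (`sum_wt3W_certI4`, `cert_identity`).  Hence `AG⁺ = −E[S] ≥ 0`.
The certificate was found by the extended LP of prim-e3grp-switch-1 (METHOD-EXTENDED-LP.md: all cells of the finite F1/F2/F4/F3′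
relaxation as constraints) on the target `AG⁺`, pool XI2, no symmetry folding, with backward elimination of programs (54 → 4); it was
checked independently by switch-1's exact relaxation checker (max `S = 0`), by exact identity + exhaustive pointwise enumeration
(75 456 triples), by an independent re-implementation of the four programs (prim-ineq-prove-3 lab/agp/indep_check.py: `E[S] = −AG⁺`
exactly on eight weighted graphs, all programs bijective), and by the Boolean abstraction below (`2¹⁶` patterns).
What is new relative to print: [GladkovZimin2024, Thm. 4.6] proves the quadratic `qt ≥ e₂` with one explored cluster; the cubic term
needs reveal-only regions handed to two different copies plus one `o_X`-feature — and only four programs.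
-/

noncomputable section

namespace Summit.CriticalPhenomena.PercolationContinuityZ3.Theorems

namespace AGPlusSwitching

open Finset Literature.Probability.Percolation Literature.Probability.Percolation.DecisionTree
open Literature.Probability.Percolation.Gladkov ThreePointLB TIncSwitching
open scoped Classical

variable {V : Type*} [Fintype V] [DecidableEq V]

/-! ### The potentials and the pointwise certificate -/

section Cert

variable (a b c : V)

/-- The pointwise certificate `S(x) = λ₀(x) + λ₁(Φ₁ x) + λ₂(Ψ₂ x) + λ₃(Ψ₃ x) + λ₄(Φ₄ x)` of certificate I4 (four programs, `±1` potentials;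
cells `Q = a|b|c = (ab)ᶜ∩(ac)ᶜ∩(bc)ᶜ`, `Pa = a|bc = bc∩(ab)ᶜ`, `Pb = ac|b = ac∩(ab)ᶜ`, `Pc = ab|c = ab∩(ac)ᶜ`, `b iso = (ab)ᶜ∩(bc)ᶜ`,
`a iso = (ab)ᶜ∩(ac)ᶜ`):
`λ₀ = −[X∈Q][Y: b≁c][Z: a≁b] + [X∈Pa][Y: b≁c][Z: a~b] − [X∈Pa][Y: b≁c][Z∈Q] − [X∈Pb][Y: b iso][Z∈Pa]`;
`λ₁(o) = −[o₁ ∈ Q][o₂: b not isolated]` on `Φ₁ = phi1 a` (`a→Y`);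
`λ₂(o) = [o₀: a≁b][o₁: b≁c][o₂: a iso]` on `Ψ₂ = psi3 b c` (`b` revealed, `c→Z`);
`λ₃(o) = [o₀: b≁c][o₁: b iso][o₂ ∈ Pa]` on `Ψ₃ = psi4 c a` (`c` revealed, `a→Y`);
`λ₄(o) = [o₁: b iso][o₂ ∈ Pc]` on `Φ₄ = phi4 a c` (`c→Z`, then `a→Y`). [this work] -/
def certI4 (x : Fin 3 → Finset (Sym2 V)) : ℝ :=
  - ind (box ((conn a b)ᶜ ∩ ((conn a c)ᶜ ∩ (conn b c)ᶜ)) (conn b c)ᶜ (conn a b)ᶜ) x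
  + ind (box (conn b c ∩ (conn a b)ᶜ) (conn b c)ᶜ (conn a b)) x
  - ind (box (conn b c ∩ (conn a b)ᶜ) (conn b c)ᶜ ((conn a b)ᶜ ∩ ((conn a c)ᶜ ∩ (conn b c)ᶜ))) x
  - ind (box (conn a c ∩ (conn a b)ᶜ) ((conn a b)ᶜ ∩ (conn b c)ᶜ) (conn b c ∩ (conn a b)ᶜ)) x
  - ind (box Set.univ ((conn a b)ᶜ ∩ ((conn a c)ᶜ ∩ (conn b c)ᶜ)) ((conn a b)ᶜ ∩ (conn b c)ᶜ)ᶜ) (phi1 a x)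
  + ind (box (conn a b)ᶜ (conn b c)ᶜ ((conn a b)ᶜ ∩ (conn a c)ᶜ)) (psi3 b c x)
  + ind (box (conn b c)ᶜ ((conn a b)ᶜ ∩ (conn b c)ᶜ) (conn b c ∩ (conn a b)ᶜ)) (psi4 c a x)
  + ind (box Set.univ ((conn a b)ᶜ ∩ (conn b c)ᶜ) (conn a b ∩ (conn a c)ᶜ)) (phi4 a c x)

end Cert

/-! ### The pointwise lemma -/

/-- **Pointwise lemma** (certificate I4): for every graph and every triple `x = (X, Y, Z)`, `S(x) = λ₀(x) + Σᵢ λᵢ(Φᵢ x) ≤ 0`.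
The memberships of the outputs are rewritten with F1/F2 (`mem_cl_splice_touch_iff`) into sixteen atomic connection statements; the
fifteen implications are cluster transitivity, monotonicity of avoiding paths, "a vertex reached avoiding `cl X c` is not in it", the
no-op cases of the reveal-only programs (`touch_sdiff_touch_eq_empty`), F3′ (`cl_subset_cl_splice_of_disjoint`) and F4
(`cl_subset_cl_splice_sdiff`, `cl_sdiff_touch_subset_cl_splice`); the finite check is `certP_nonpos`. [this work] -/
theorem certI4_nonpos (a b c : V) (x : Fin 3 → Finset (Sym2 V)) : certI4 a b c x ≤ 0 := by
  have hca : ∀ K : Finset (Sym2 V), a ∈ cl K c ↔ c ∈ cl K a := fun K => mem_cl_comm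
  have hcb : ∀ K : Finset (Sym2 V), b ∈ cl K c ↔ c ∈ cl K b := fun K => mem_cl_comm
  simp only [certI4, ind_eq_pind, mem_box, phi1_zero, phi1_one, phi1_two, phi4_zero, phi4_one, phi4_two,
    psi3_zero, psi3_one, psi3_two, psi4_zero, psi4_one, psi4_two, Set.mem_inter_iff, Set.mem_compl_iff,
    Set.mem_univ, true_and, mem_conn_iff_mem_cl, mem_cl_splice_touch_root, mem_cl_splice_touch_root']
  simp only [mem_cl_splice_touch_iff, hca, hcb]
  refine certP_nonpos _ _ _ _ _ _ _ _ _ _ _ _ _ _ _ _ ?_ ?_ ?_ ?_ ?_ ?_ ?_ ?_ ?_ ?_ ?_ ?_ ?_ ?_ ?_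
  · -- h1: b, c ∈ cl X a ⟹ c ∈ cl X b
    exact fun hab hac => mem_cl_trans (mem_cl_comm.1 hab) hac
  · -- h2: c ∈ cl X a, c ∈ cl X b ⟹ b ∈ cl X a
    exact fun hac hbc => mem_cl_trans hac ((hcb _).2 hbc)
  · -- h3: a Y-path avoiding cl X a is a Y-path
    exact fun h => cl_mono Finset.sdiff_subset b h
  · -- h4: a Z-path avoiding cl X c is a Z-path
    exact fun h => cl_mono Finset.sdiff_subset a h
  · -- h5: a vertex reached from a ∉ cl X c avoiding cl X c is not in cl X c
    exact fun hac hzp hbc => not_mem_of_mem_cl_sdiff_touch (fun h => hac ((hca _).1 h)) hzp ((hcb _).2 hbc)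
  · -- h6: Ψ₂ is the identity when c ∈ cl X b
    intro hbc; rw [touch_sdiff_touch_eq_empty hbc, splice_empty]
  · -- h7
    intro hbc; rw [touch_sdiff_touch_eq_empty hbc, splice_empty]
  · -- h8: F3′ for Ψ₂ (cl X b is untouched by the region, which avoids touch (cl X b))
    exact fun hab => mem_cl_comm.1
      (cl_subset_cl_splice_of_disjoint (fun e he => (Finset.mem_sdiff.1 he).2) (mem_cl_comm.1 hab))
  · -- h9: F4(i) for Ψ₂: cl X c stays connected in the Z-output
    exact fun hbc hac => mem_cl_comm.1 (cl_subset_cl_splice_sdiff hbc (x 2) ((hca _).2 hac))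
  · -- h10: F4(ii) for Ψ₂: a Z-path avoiding cl X c survives
    exact fun h => cl_sdiff_touch_subset_cl_splice Finset.sdiff_subset a h
  · -- h11: Ψ₃ (and the second region of Φ₄) is trivial when a ∈ cl X c
    intro hac; rw [touch_sdiff_touch_eq_empty ((hca _).2 hac), splice_empty]
  · -- h12
    intro hac; rw [touch_sdiff_touch_eq_empty ((hca _).2 hac), splice_empty]
  · -- h13: F3′ for Ψ₃ (cl X c untouched)
    exact fun hbc => mem_cl_comm.1
      (cl_subset_cl_splice_of_disjoint (fun e he => (Finset.mem_sdiff.1 he).2) ((hcb _).2 hbc))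
  · -- h14: F4(i) for Ψ₃/Φ₄: cl X a stays connected in the Y-output
    exact fun hac hab => cl_subset_cl_splice_sdiff (fun h => hac ((hca _).1 h)) (x 1) hab
  · -- h15: F4(ii) for Ψ₃/Φ₄: a Y-path avoiding cl X a survives
    exact fun h => cl_sdiff_touch_subset_cl_splice Finset.sdiff_subset b h

/-! ### The expectation of the certificate is `−AG⁺` -/

section Expectation

variable (p : Sym2 V → ℝ) (D : Finset (Sym2 V)) (a b c : V)

/-- `E[S] = E[λ₀] + Σᵢ E[λᵢ]`, each `E[λᵢ ∘ Φᵢ] = E[λᵢ]` by measure preservation and each `E[λᵢ]` a product of three `PrW`'s. [this work] -/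
theorem sum_wt3W_certI4 :
    ∑ x ∈ triples D, wt3W D p x * certI4 a b c x =
      - (PrW D p ((conn a b)ᶜ ∩ ((conn a c)ᶜ ∩ (conn b c)ᶜ)) * PrW D p (conn b c)ᶜ * PrW D p (conn a b)ᶜ)
      + PrW D p (conn b c ∩ (conn a b)ᶜ) * PrW D p (conn b c)ᶜ * PrW D p (conn a b)
      - PrW D p (conn b c ∩ (conn a b)ᶜ) * PrW D p (conn b c)ᶜ * PrW D p ((conn a b)ᶜ ∩ ((conn a c)ᶜ ∩ (conn b c)ᶜ))
      - PrW D p (conn a c ∩ (conn a b)ᶜ) * PrW D p ((conn a b)ᶜ ∩ (conn b c)ᶜ) * PrW D p (conn b c ∩ (conn a b)ᶜ)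
      - PrW D p Set.univ * PrW D p ((conn a b)ᶜ ∩ ((conn a c)ᶜ ∩ (conn b c)ᶜ)) * PrW D p ((conn a b)ᶜ ∩ (conn b c)ᶜ)ᶜ
      + PrW D p (conn a b)ᶜ * PrW D p (conn b c)ᶜ * PrW D p ((conn a b)ᶜ ∩ (conn a c)ᶜ)
      + PrW D p (conn b c)ᶜ * PrW D p ((conn a b)ᶜ ∩ (conn b c)ᶜ) * PrW D p (conn b c ∩ (conn a b)ᶜ)
      + PrW D p Set.univ * PrW D p ((conn a b)ᶜ ∩ (conn b c)ᶜ) * PrW D p (conn a b ∩ (conn a c)ᶜ) := by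
  have h1 : ∀ E₀ E₁ E₂ : Set (Finset (Sym2 V)),
      ∑ x ∈ triples D, wt3W D p x * ind (box E₀ E₁ E₂) (phi1 a x) = PrW D p E₀ * PrW D p E₁ * PrW D p E₂ :=
    fun E₀ E₁ E₂ => by rw [sum_wt3W_phi1 p D a (ind (box E₀ E₁ E₂)), sum_wt3W_ind_box]
  have h2 : ∀ E₀ E₁ E₂ : Set (Finset (Sym2 V)),
      ∑ x ∈ triples D, wt3W D p x * ind (box E₀ E₁ E₂) (psi3 b c x) = PrW D p E₀ * PrW D p E₁ * PrW D p E₂ :=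
    fun E₀ E₁ E₂ => by rw [sum_wt3W_psi3 p D b c (ind (box E₀ E₁ E₂)), sum_wt3W_ind_box]
  have h3 : ∀ E₀ E₁ E₂ : Set (Finset (Sym2 V)),
      ∑ x ∈ triples D, wt3W D p x * ind (box E₀ E₁ E₂) (psi4 c a x) = PrW D p E₀ * PrW D p E₁ * PrW D p E₂ :=
    fun E₀ E₁ E₂ => by rw [sum_wt3W_psi4 p D c a (ind (box E₀ E₁ E₂)), sum_wt3W_ind_box]
  have h4 : ∀ E₀ E₁ E₂ : Set (Finset (Sym2 V)),
      ∑ x ∈ triples D, wt3W D p x * ind (box E₀ E₁ E₂) (phi4 a c x) = PrW D p E₀ * PrW D p E₁ * PrW D p E₂ :=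
    fun E₀ E₁ E₂ => by rw [sum_wt3W_phi4 p D a c (ind (box E₀ E₁ E₂)), sum_wt3W_ind_box]
  simp only [certI4, mul_add, mul_sub, mul_neg, Finset.sum_add_distrib, Finset.sum_sub_distrib,
    Finset.sum_neg_distrib, sum_wt3W_ind_box, h1, h2, h3, h4]

end Expectation

/-! ### The theorem at the finitary level -/

section Main

variable {p : Sym2 V → ℝ} (hp0 : ∀ i, 0 ≤ p i) (hp1 : ∀ i, p i ≤ 1) (D : Finset (Sym2 V)) (a b c : V)
include hp0 hp1

/-- **`AG⁺` at the finitary level.**  With `t = P(abc)`, `q = P(a|b|c)`, `u_c = P(ab|c)`, `u_b = P(ac|b)`, `u_a = P(bc|a)`: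
`u_c u_b u_a ≤ q t − (u_c u_b + u_c u_a + u_b u_a)`.  Proof: `0 ≥ E[S] = −AG⁺`. [this work] -/
theorem agPlus_PrW :
    PrW D p (conn a b ∩ (conn a c)ᶜ) * PrW D p (conn a c ∩ (conn a b)ᶜ) * PrW D p (conn b c ∩ (conn a b)ᶜ) ≤
      PrW D p ((conn a b)ᶜ ∩ ((conn a c)ᶜ ∩ (conn b c)ᶜ)) * PrW D p (conn a b ∩ conn a c) -
        (PrW D p (conn a b ∩ (conn a c)ᶜ) * PrW D p (conn a c ∩ (conn a b)ᶜ) +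
          PrW D p (conn a b ∩ (conn a c)ᶜ) * PrW D p (conn b c ∩ (conn a b)ᶜ) +
          PrW D p (conn a c ∩ (conn a b)ᶜ) * PrW D p (conn b c ∩ (conn a b)ᶜ)) := by
  -- transitivity of connection, at the level of events
  have t1 : ∀ K : Finset (Sym2 V), K ∈ conn a c → K ∈ conn b c → K ∈ conn a b :=
    fun K hac hbc => mem_conn.2 ((mem_conn.1 hac).trans (mem_conn.1 hbc).symm)
  have t2 : ∀ K : Finset (Sym2 V), K ∈ conn a b → K ∈ conn b c → K ∈ conn a c :=
    fun K hab hbc => mem_conn.2 ((mem_conn.1 hab).trans (mem_conn.1 hbc))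
  have t3 : ∀ K : Finset (Sym2 V), K ∈ conn a b → K ∈ conn a c → K ∈ conn b c :=
    fun K hab hac => mem_conn.2 ((mem_conn.1 hab).symm.trans (mem_conn.1 hac))
  -- the linear relations among the events (cells: q, t, uc = ab|c, ub = ac|b, ua = bc|a)
  have R1 : PrW D p ((conn a b)ᶜ ∩ (conn b c)ᶜ)ᶜ = 1 - PrW D p ((conn a b)ᶜ ∩ (conn b c)ᶜ) := by
    have h := PrW_union D p (Set.disjoint_left.2 fun K (h1 : K ∈ (conn a b)ᶜ ∩ (conn b c)ᶜ)
      (h2 : K ∈ ((conn a b)ᶜ ∩ (conn b c)ᶜ)ᶜ) => h2 h1)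
    rw [Set.union_compl_self, PrW_univ] at h
    linarith
  have R2 : PrW D p ((conn a b)ᶜ ∩ (conn a c)ᶜ) =
      PrW D p ((conn a b)ᶜ ∩ ((conn a c)ᶜ ∩ (conn b c)ᶜ)) + PrW D p (conn b c ∩ (conn a b)ᶜ) := by
    rw [← PrW_union D p]
    · refine PrW_congr_set D p fun K _ => ?_
      simp only [Set.mem_union, Set.mem_inter_iff, Set.mem_compl_iff]
      have := t1 K; tauto
    · exact Set.disjoint_left.2 fun K h1 h2 => h1.2.2 h2.1
  have R3 : PrW D p (conn a b)ᶜ = PrW D p ((conn a b)ᶜ ∩ ((conn a c)ᶜ ∩ (conn b c)ᶜ)) +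
      PrW D p (conn b c ∩ (conn a b)ᶜ) + PrW D p (conn a c ∩ (conn a b)ᶜ) := by
    rw [← PrW_union D p, ← PrW_union D p]
    · refine PrW_congr_set D p fun K _ => ?_
      simp only [Set.mem_union, Set.mem_inter_iff, Set.mem_compl_iff]
      have := t1 K; tauto
    · exact Set.disjoint_left.2 fun K h1 h2 => by
        rcases h1 with h1 | h1
        · exact h1.2.1 h2.1
        · exact h1.2 (t1 K h2.1 h1.1)
    · exact Set.disjoint_left.2 fun K h1 h2 => h1.2.2 h2.1
  have R4 : PrW D p ((conn a b)ᶜ ∩ (conn b c)ᶜ) =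
      PrW D p ((conn a b)ᶜ ∩ ((conn a c)ᶜ ∩ (conn b c)ᶜ)) + PrW D p (conn a c ∩ (conn a b)ᶜ) := by
    rw [← PrW_union D p]
    · refine PrW_congr_set D p fun K _ => ?_
      simp only [Set.mem_union, Set.mem_inter_iff, Set.mem_compl_iff]
      have := t3 K; tauto
    · exact Set.disjoint_left.2 fun K h1 h2 => h1.2.1 h2.1
  have R5 : PrW D p (conn b c)ᶜ = PrW D p ((conn a b)ᶜ ∩ ((conn a c)ᶜ ∩ (conn b c)ᶜ)) +
      PrW D p (conn a c ∩ (conn a b)ᶜ) + PrW D p (conn a b ∩ (conn a c)ᶜ) := by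
    rw [← PrW_union D p, ← PrW_union D p]
    · refine PrW_congr_set D p fun K _ => ?_
      simp only [Set.mem_union, Set.mem_inter_iff, Set.mem_compl_iff]
      have := t1 K; have := t2 K; have := t3 K; tauto
    · exact Set.disjoint_left.2 fun K h1 h2 => by
        rcases h1 with h1 | h1
        · exact h1.1 h2.1
        · exact h1.2 h2.1
    · exact Set.disjoint_left.2 fun K h1 h2 => h1.2.1 h2.1
  have R6 : PrW D p (conn a b) = PrW D p (conn a b ∩ (conn a c)ᶜ) + PrW D p (conn a b ∩ conn a c) := by
    rw [← PrW_union D p]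
    · refine PrW_congr_set D p fun K _ => ?_
      simp only [Set.mem_union, Set.mem_inter_iff, Set.mem_compl_iff]
      tauto
    · exact Set.disjoint_left.2 fun K h1 h2 => h1.2 h2.2
  have R8 : PrW D p (conn a b) + PrW D p (conn a b)ᶜ = 1 := by
    rw [← PrW_union D p, Set.union_compl_self, PrW_univ]
    exact Set.disjoint_left.2 fun K h1 h2 => h2 h1
  have hU : PrW D p (Set.univ : Set (Finset (Sym2 V))) = 1 := PrW_univ D p
  -- E[S] ≤ 0
  have hle : ∑ x ∈ triples D, wt3W D p x * certI4 a b c x ≤ 0 :=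
    Finset.sum_nonpos fun x _ =>
      mul_nonpos_of_nonneg_of_nonpos (DTree3.wt3W_nonneg D hp0 hp1 x) (certI4_nonpos a b c x)
  rw [sum_wt3W_certI4, R1, R2, R3, R4, R5, R6, hU] at hle
  set q := PrW D p ((conn a b)ᶜ ∩ ((conn a c)ᶜ ∩ (conn b c)ᶜ))
  set t := PrW D p (conn a b ∩ conn a c)
  set uc := PrW D p (conn a b ∩ (conn a c)ᶜ)
  set ub := PrW D p (conn a c ∩ (conn a b)ᶜ)
  set ua := PrW D p (conn b c ∩ (conn a b)ᶜ)
  have hsum : q + ua + ub + uc + t = 1 := by linarith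
  rw [cert_identity q ua ub uc t hsum] at hle
  linarith

end Main

end AGPlusSwitching

/-! ### The theorem for `prodBernoulli w` -/

namespace AGPlusSwitching

section Measure

open Finset Literature.Probability.Percolation Literature.Probability.Percolation.DecisionTree
open Literature.Probability.Percolation.Gladkov
open MeasureTheory Literature.Probability.LatticeModels
open scoped Classical

variable {V : Type*} [Finite V]

/-- **THEOREM (`AG⁺`, every finite weighted graph).**  For `μ = prodBernoulli w` and vertices `a b c`, with `t = μ(ab ∩ ac)`,
`q = μ(a|b|c)`, `u_c = μ(ab|c)`, `u_b = μ(ac|b)`, `u_a = μ(a|bc)`:  `u_c u_b u_a ≤ q t − (u_c u_b + u_c u_a + u_b u_a)` — the Aas–Gladkov /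
strong Harris–Kleitman inequality `q t ≥ e₂(u)` [Gladkov2024StrongFKG, Cor. 4.2] sharpened by the cubic term; exactly the hypothesis `hG3`
of `sahiE3_pairSep_nonneg_of_G3` (`…ThreePointRowLinks`). [this work] -/
theorem agPlus_prodBernoulli (w : Sym2 V → unitInterval) (a b c : V) :
    (prodBernoulli w).real (openConn a b ∩ (openConn a c)ᶜ) *
          (prodBernoulli w).real (openConn a c ∩ (openConn a b)ᶜ) *
          (prodBernoulli w).real (openConn b c ∩ (openConn a b)ᶜ) ≤
      (prodBernoulli w).real ((openConn a b)ᶜ ∩ (openConn a c)ᶜ ∩ (openConn b c)ᶜ) *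
          (prodBernoulli w).real (openConn a b ∩ openConn a c) -
        ((prodBernoulli w).real (openConn a b ∩ (openConn a c)ᶜ) *
            (prodBernoulli w).real (openConn a c ∩ (openConn a b)ᶜ) +
          (prodBernoulli w).real (openConn a b ∩ (openConn a c)ᶜ) *
            (prodBernoulli w).real (openConn b c ∩ (openConn a b)ᶜ) +
          (prodBernoulli w).real (openConn a c ∩ (openConn a b)ᶜ) *
            (prodBernoulli w).real (openConn b c ∩ (openConn a b)ᶜ)) := by
  obtain ⟨_instV⟩ := nonempty_fintype V
  have hp0 : ∀ e, 0 ≤ (w e : ℝ) := fun e => (w e).2.1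
  have hp1 : ∀ e, (w e : ℝ) ≤ 1 := fun e => (w e).2.2
  have key := agPlus_PrW (p := fun e => (w e : ℝ)) hp0 hp1 Finset.univ a b c
  have hco : ∀ (S : Finset (Sym2 V)) (u v : V),
      (↑S : Set (Sym2 V)) ∈ openConn u v ↔ (openGraph (↑S : Set (Sym2 V))).Reachable u v :=
    fun _ _ _ => Iff.rfl
  have e1 : (prodBernoulli w).real (openConn a b ∩ openConn a c) =
      PrW Finset.univ (fun e => (w e : ℝ)) (conn a b ∩ conn a c) :=
    prodBernoulli_real_eq_PrW_univ w fun S => by simp only [Set.mem_inter_iff, mem_conn, hco]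
  have e2 : (prodBernoulli w).real ((openConn a b)ᶜ ∩ (openConn a c)ᶜ ∩ (openConn b c)ᶜ) =
      PrW Finset.univ (fun e => (w e : ℝ)) ((conn a b)ᶜ ∩ ((conn a c)ᶜ ∩ (conn b c)ᶜ)) :=
    prodBernoulli_real_eq_PrW_univ w fun S => by
      simp only [Set.mem_inter_iff, Set.mem_compl_iff, mem_conn, hco, and_assoc]
  have e3 : (prodBernoulli w).real (openConn a b ∩ (openConn a c)ᶜ) =
      PrW Finset.univ (fun e => (w e : ℝ)) (conn a b ∩ (conn a c)ᶜ) :=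
    prodBernoulli_real_eq_PrW_univ w fun S => by simp only [Set.mem_inter_iff, Set.mem_compl_iff, mem_conn, hco]
  have e4 : (prodBernoulli w).real (openConn a c ∩ (openConn a b)ᶜ) =
      PrW Finset.univ (fun e => (w e : ℝ)) (conn a c ∩ (conn a b)ᶜ) :=
    prodBernoulli_real_eq_PrW_univ w fun S => by simp only [Set.mem_inter_iff, Set.mem_compl_iff, mem_conn, hco]
  have e5 : (prodBernoulli w).real (openConn b c ∩ (openConn a b)ᶜ) =
      PrW Finset.univ (fun e => (w e : ℝ)) (conn b c ∩ (conn a b)ᶜ) :=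
    prodBernoulli_real_eq_PrW_univ w fun S => by simp only [Set.mem_inter_iff, Set.mem_compl_iff, mem_conn, hco]
  rw [e1, e2, e3, e4, e5]
  exact key

/-- **Corollary: the Aas–Gladkov excess dominates the cubic term, which is nonnegative**: `0 ≤ e₃(u) ≤ qt − e₂(u)`. [this work] -/
theorem agExcess_nonneg_of_agPlus (w : Sym2 V → unitInterval) (a b c : V) :
    0 ≤ (prodBernoulli w).real ((openConn a b)ᶜ ∩ (openConn a c)ᶜ ∩ (openConn b c)ᶜ) *
          (prodBernoulli w).real (openConn a b ∩ openConn a c) -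
        ((prodBernoulli w).real (openConn a b ∩ (openConn a c)ᶜ) *
            (prodBernoulli w).real (openConn a c ∩ (openConn a b)ᶜ) +
          (prodBernoulli w).real (openConn a b ∩ (openConn a c)ᶜ) *
            (prodBernoulli w).real (openConn b c ∩ (openConn a b)ᶜ) +
          (prodBernoulli w).real (openConn a c ∩ (openConn a b)ᶜ) *
            (prodBernoulli w).real (openConn b c ∩ (openConn a b)ᶜ)) := by
  have h := agPlus_prodBernoulli w a b c
  have h0 : 0 ≤ (prodBernoulli w).real (openConn a b ∩ (openConn a c)ᶜ) *
      (prodBernoulli w).real (openConn a c ∩ (openConn a b)ᶜ) *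
      (prodBernoulli w).real (openConn b c ∩ (openConn a b)ᶜ) :=
    mul_nonneg (mul_nonneg measureReal_nonneg measureReal_nonneg) measureReal_nonneg
  linarith

end Measure

end AGPlusSwitching

end Summit.CriticalPhenomena.PercolationContinuityZ3.Theorems

end
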